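import Summits.BirchSwinnertonDyer.Rank1Residual.WAll.ConjunctionGrossZagier
import HarnessLib

/-!
# Rung W-ALL (D-0120): the registry theorem `wAll_of_leaves` with the Gross–Zagier side PRIMARY —
# W-ALL, and its leading-term form, FROM THE REGISTERED LEAVES modulo single-theorem print facts
# (cell `bsd-wall`, lane 2, seat ty-2; glue of `AltClosersGlue.lean` to ty-1's `ConjunctionGrossZagier`)

HONEST FRAMING (cell `bsd-wall`, run/shared/lean/pub/bsd-wall/; WALL-BRIEF-v1 §2). NOTHING ASSERTED:
no `def`, no `@[conjecture]`, no named fact, no route file imported; W-ALL is OPEN and this file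
proves bookkeeping only. `AltClosersGlue.lean` (p489382) proves `wAll_of_leaves`: W-ALL from the
REGISTERED RUNG LEAVES of LADDER-BSD §1c (K4, K1, K8, K9t, K9w, K2a, K2b, K5, K3, K6, the typed
targets X10b / X11a, the CM leaf K8-CM, ty-1's two open CM sub-corners, the additive upper half
`hUp`, `sha_dvd_analyticSha`) and the FOURTEEN print binders of `CornersAll`;
`ConjunctionYanZhu.lean` (`wAll_of_leaves_yanZhuImForm`) drops `hBCS` (through Yan–Zhu's printed
(Im) form), derives `hmod` from `hmodP` and discharges Wuthrich's Lemma 20 — ELEVEN binders. Both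
keep the COMPOSITE rank binder `hGZK : rank_eq_analyticRank_of_analyticRank_le_one`
(Gross–Zagier–Kolyvagin, Darmon 2004 Thm. 3.22), which the leaves → closed-list step itself consumes
(rows 2, 6–9, 12). Seat ty-1's `ConjunctionGrossZagier.lean` (p499498) feeds `hGZK` from its ROAD
OF RECORD `rank_eq_analyticRank_of_analyticRank_le_one_of_nonempty_modularParametrizationData`
(`HeegnerPointsModularityProofs`: modularity (6) `hmodP`, Waldspurger 1985 `hWa`, Murty–Murty 1991
`hMM`, Gross–Zagier 1986 Thm. V.(2.1) `hGZ`, Kolyvagin 1990 Thm. A `hKo`) and the rank-one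
Gross–Zagier sign binder from `gross_zagier_rank_one_rat_of_nonempty_modularParametrizationData`.
This file is the composition, so that the registry theorem exists in the same currency:

* `wAll_of_leaves_primaryGZ` — W-ALL from the leaves, `hmod` derived, `hW20` discharged, `hGZK`
  fed from its road of record: the 17 leaf / target / residual / Ш-divisibility hypotheses of
  `wAll_of_leaves` and FIFTEEN named facts `hSk hBCS hJSW hCGS hGV hGr hmodP hWa hMM hGZ hKo hCM
  hKob hYZ hLLT`, each on the Gross–Zagier side ONE printed theorem.
* `wAll_of_leaves_yanZhuImForm_primaryGZ` — the same on the eleven-fact Yan–Zhu (Im) kernel: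
  FOURTEEN named facts (no `hBCS`; `hYZ` in printed (Im) form).
* `wAllFormula_of_leaves_primaryGZ` / `wAllFormula_of_leaves_yanZhuImForm_primaryGZ` — the
  leading-term form `WAllFormula` (the full BSD formula for every `E/ℚ` of analytic rank `≤ 1`)
  from the leaves with ONE sign binder `hL0 : re_entireLFunction_one_nonneg`: 15 + 1 = 16, resp.
  14 + 1 = 15 named facts, neither `rank_eq_analyticRank_of_analyticRank_le_one` nor
  `gross_zagier_rank_one_rat` among them.

COUNTS, EXACTLY: `wAll_of_leaves` has 17 + 14 = 31 hypotheses (composites `hGZK`, and `hmod`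
beside `hmodP`); `wAll_of_leaves_yanZhuImForm` 17 + 11 = 28; the forms here 17 + 15 = 32 and
17 + 14 = 31 — more names, zero composite names on the Gross–Zagier side. No census number moves;
typed ≠ proved ≠ endorsed; BSD is not proved by any of this.

References: `WAll/AltClosersGlue.lean`, `WAll/ConjunctionYanZhu.lean`, `WAll/ConjunctionGrossZagier.lean`;
[cite: Darmon2004, Thm. 3.22 and §3.9]; [cite: GrossZagier1986, Thm. V.(2.1) (p. 311) and V.§2
(pp. 312–313)]; WALL-BRIEF-v1.md §2; LADDER-BSD.md §1c.
-/

noncomputable section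

open scoped Classical

open WeierstrassCurve Literature.NumberTheory.EllipticCurves
  Literature.NumberTheory.EllipticCurves.Rank1Residual
  Literature.NumberTheory.EllipticCurves.Rank1Residual.Typed
  Literature.NumberTheory.EllipticCurves.Wuthrich2014
  Literature.NumberTheory.EllipticCurves.ModularForms

set_option autoImplicit false

namespace Summit.BirchSwinnertonDyer.Rank1Residual.WAll

open Summit.BirchSwinnertonDyer
open Summit.BirchSwinnertonDyer.BirchSwinnertonDyer.Rank1Residual (NonCMAtTwo BSDpOnClassX9)

/-! ## §1 W-ALL from the registered leaves, the Gross–Zagier side primary -/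

/-- **W-ALL FROM THE REGISTERED LEAVES, FIFTEEN named facts, the Gross–Zagier side primary**
(`wAll_of_exclusions_primaryGZ ∘ wAllExclusions_of_leaves`): every hypothesis is a registered rung
leaf (K4, K1, K8, K9t, K9w, K2a, K2b, K5, K3, K6, K8-CM), a typed cell target (X10b, X11a), one of
the three named residual statements (`hUp`, `WAllCornerFTwo`, `WAllCornerFRamified`),
`sha_dvd_analyticSha`, or one of FIFTEEN named published facts of the tree — Skinner 2016 Thm C ·
BCS25 Cor 1.3.1 · JSW17 Thm 1.2.1 · CGS25 Thm D · Greenberg–Vatsal 2000 Thm 1.3 · Greenberg 1999 ·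
BCDT 2001 Thm A (6) · Waldspurger 1985 Thm 5 · Murty–Murty 1991 · Gross–Zagier 1986 V.(2.1) ·
Kolyvagin 1990 Thm A · Rubin 1991 / Burungale–Flach 2024 · Kobayashi 2013 Cor 1.4 · Yan–Zhu 2026
Thm 4.15 · Li–Liu–Tian 2024 Thm 1.1. The rank binder `hGZK` consumed by the leaves → closed-list
step and by the kernel is fed from its road of record; `hmod` is derived from `hmodP`; Wuthrich
2014 Lemma 20 is discharged inside `ConjunctionDischarged`. [cite: Darmon2004, Thm. 3.22 and §3.9] -/
theorem wAll_of_leaves_primaryGZ (h5 : NonCMAtTwo)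
    (hK1 : Additive.AdditiveOrdinaryLowerHalf)
    (hUp : ∀ (W : WeierstrassCurve ℚ) [W.IsElliptic] [W.IsGloballyMinimal] (p : ℕ) [Fact p.Prime],
      W.analyticRank ≤ 1 → Additive.N10.Locus W p → MissingUpperBoundAt W p)
    (hK8 : Additive.O5SharpGss) (hK9t : Additive.O5SharpTprime) (hK9w : Additive.O6Sharp)
    (hK2a : X11b.MultiplicativeRankOne) (hK2b : X11b.MultiplicativeRankOneAtThree)
    (hK5 : Eisenstein.EisensteinPrimes) (hK3 : Supersingular.SignedSupersingular)
    (hK6 : BSDpOnClassX9) (hX10b : X10.BSDpOnClassX10b) (hX11a : X11a.Target)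
    (hIn : X12.CMInertBad) (hF2 : WAllCornerFTwo) (hFr : WAllCornerFRamified)
    (hW : sha_dvd_analyticSha)
    -- fifteen named facts, the Gross–Zagier side primary
    (hSk : Skinner2016.thmC_padicValRat_bsd_rank_zero)
    (hBCS : BurungaleCastellaSkinner2025.cor131_padicValRat_bsd_rank_le_one)
    (hJSW : JetchevSkinnerWan2017.thm121_padicValRat_bsd_rank_one)
    (hCGS : CastellaGrossiSkinner2025.thmD_padicValRat_bsd_rank_le_one)
    (hGV : GreenbergVatsal2000.thm13_charIdeal_eq_of_gvPar) (hGr : greenberg_charValue_rankZero)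
    (hmodP : nonempty_modularParametrizationData)
    (hWa : waldspurger_exists_heegnerField_twist_ne_zero)
    (hMM : murtyMurty_exists_heegnerField_twist_simpleZero)
    (hGZ : ∀ (N : ℕ) [NeZero N] (W : WeierstrassCurve ℚ) (K : Type) [Field K] [NumberField K],
      gross_zagier N W K)
    (hKo : ∀ (N : ℕ) [NeZero N] (W : WeierstrassCurve ℚ) (K : Type) [Field K] [NumberField K],
      kolyvagin N W K)
    (hCM : bsdTriple_of_hasCM_of_L_one_ne_zero) (hKob : Kobayashi2013.cor14_bsdp_of_cm_rank_one)
    (hYZ : YanZhu2026.thm415_padicValRat_bsd_rank_le_one)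
    (hLLT : LiLiuTian2024.thm11_bsdp_of_cm_rank_one) : WAll :=
  wAll_of_exclusions_primaryGZ
    (wAllExclusions_of_leaves h5 hK1 hUp hK8 hK9t hK9w hK2a hK2b hK5 hK3 hK6 hX10b hX11a hIn hF2 hFr
      hW (X2.ClassClosureEntireFree.hasEntireLFunction_rat_of_nonempty_modularParametrizationData hmodP)
      (rank_eq_analyticRank_of_analyticRank_le_one_of_nonempty_modularParametrizationData hmodP hWa
        hMM hGZ hKo)
      hLLT)
    hSk hBCS hJSW hCGS hGV hGr hmodP hWa hMM hGZ hKo hCM hKob hYZ hLLT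

/-- **W-ALL FROM THE REGISTERED LEAVES, FOURTEEN named facts** — the same on the eleven-fact
Yan–Zhu (Im) kernel of `ConjunctionYanZhu` (`hBCS` dropped through `RowC2.bcsCor131_of_yanZhuImForm`,
`hYZ` in its printed (Im) form), the Gross–Zagier side primary. [cite: Darmon2004, Thm. 3.22 and §3.9] -/
theorem wAll_of_leaves_yanZhuImForm_primaryGZ (h5 : NonCMAtTwo)
    (hK1 : Additive.AdditiveOrdinaryLowerHalf)
    (hUp : ∀ (W : WeierstrassCurve ℚ) [W.IsElliptic] [W.IsGloballyMinimal] (p : ℕ) [Fact p.Prime],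
      W.analyticRank ≤ 1 → Additive.N10.Locus W p → MissingUpperBoundAt W p)
    (hK8 : Additive.O5SharpGss) (hK9t : Additive.O5SharpTprime) (hK9w : Additive.O6Sharp)
    (hK2a : X11b.MultiplicativeRankOne) (hK2b : X11b.MultiplicativeRankOneAtThree)
    (hK5 : Eisenstein.EisensteinPrimes) (hK3 : Supersingular.SignedSupersingular)
    (hK6 : BSDpOnClassX9) (hX10b : X10.BSDpOnClassX10b) (hX11a : X11a.Target)
    (hIn : X12.CMInertBad) (hF2 : WAllCornerFTwo) (hFr : WAllCornerFRamified)
    (hW : sha_dvd_analyticSha)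
    -- fourteen named facts, the Gross–Zagier side primary
    (hSk : Skinner2016.thmC_padicValRat_bsd_rank_zero)
    (hJSW : JetchevSkinnerWan2017.thm121_padicValRat_bsd_rank_one)
    (hCGS : CastellaGrossiSkinner2025.thmD_padicValRat_bsd_rank_le_one)
    (hGV : GreenbergVatsal2000.thm13_charIdeal_eq_of_gvPar) (hGr : greenberg_charValue_rankZero)
    (hmodP : nonempty_modularParametrizationData)
    (hWa : waldspurger_exists_heegnerField_twist_ne_zero)
    (hMM : murtyMurty_exists_heegnerField_twist_simpleZero)
    (hGZ : ∀ (N : ℕ) [NeZero N] (W : WeierstrassCurve ℚ) (K : Type) [Field K] [NumberField K],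
      gross_zagier N W K)
    (hKo : ∀ (N : ℕ) [NeZero N] (W : WeierstrassCurve ℚ) (K : Type) [Field K] [NumberField K],
      kolyvagin N W K)
    (hCM : bsdTriple_of_hasCM_of_L_one_ne_zero) (hKob : Kobayashi2013.cor14_bsdp_of_cm_rank_one)
    (hYZ : YanZhu2026.thm415_padicValRat_bsd_rank_le_one_of_bigIm)
    (hLLT : LiLiuTian2024.thm11_bsdp_of_cm_rank_one) : WAll :=
  wAll_of_leaves_yanZhuImForm h5 hK1 hUp hK8 hK9t hK9w hK2a hK2b hK5 hK3 hK6 hX10b hX11a hIn hF2 hFr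
    hW hSk hJSW hCGS hGV hGr hmodP
    (rank_eq_analyticRank_of_analyticRank_le_one_of_nonempty_modularParametrizationData hmodP hWa hMM
      hGZ hKo)
    hCM hKob hYZ hLLT

/-! ## §2 The leading-term form from the registered leaves, ONE sign binder -/

/-- **THE FULL BSD FORMULA FOR EVERY `E/ℚ` OF ANALYTIC RANK `≤ 1`, FROM THE REGISTERED LEAVES**,
FIFTEEN named facts and ONE sign binder `hL0 : re_entireLFunction_one_nonneg` (`L(E,1) ≥ 0`;
Guo 1996 / Lapid–Rallis 2003 Thm. 1): `wAllFormula_of_wAll_oneSign ∘ wAll_of_leaves_primaryGZ`.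
Neither `rank_eq_analyticRank_of_analyticRank_le_one` nor `gross_zagier_rank_one_rat` is a
hypothesis. [cite: GrossZagier1986, Thm. V.(2.1) (p. 311) and V.§2 (pp. 312–313)]
[cite: Darmon2004, Thm. 3.22 and §3.9] -/
theorem wAllFormula_of_leaves_primaryGZ (h5 : NonCMAtTwo)
    (hK1 : Additive.AdditiveOrdinaryLowerHalf)
    (hUp : ∀ (W : WeierstrassCurve ℚ) [W.IsElliptic] [W.IsGloballyMinimal] (p : ℕ) [Fact p.Prime],
      W.analyticRank ≤ 1 → Additive.N10.Locus W p → MissingUpperBoundAt W p)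
    (hK8 : Additive.O5SharpGss) (hK9t : Additive.O5SharpTprime) (hK9w : Additive.O6Sharp)
    (hK2a : X11b.MultiplicativeRankOne) (hK2b : X11b.MultiplicativeRankOneAtThree)
    (hK5 : Eisenstein.EisensteinPrimes) (hK3 : Supersingular.SignedSupersingular)
    (hK6 : BSDpOnClassX9) (hX10b : X10.BSDpOnClassX10b) (hX11a : X11a.Target)
    (hIn : X12.CMInertBad) (hF2 : WAllCornerFTwo) (hFr : WAllCornerFRamified)
    (hW : sha_dvd_analyticSha)
    (hSk : Skinner2016.thmC_padicValRat_bsd_rank_zero)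
    (hBCS : BurungaleCastellaSkinner2025.cor131_padicValRat_bsd_rank_le_one)
    (hJSW : JetchevSkinnerWan2017.thm121_padicValRat_bsd_rank_one)
    (hCGS : CastellaGrossiSkinner2025.thmD_padicValRat_bsd_rank_le_one)
    (hGV : GreenbergVatsal2000.thm13_charIdeal_eq_of_gvPar) (hGr : greenberg_charValue_rankZero)
    (hmodP : nonempty_modularParametrizationData)
    (hWa : waldspurger_exists_heegnerField_twist_ne_zero)
    (hMM : murtyMurty_exists_heegnerField_twist_simpleZero)
    (hGZ : ∀ (N : ℕ) [NeZero N] (W : WeierstrassCurve ℚ) (K : Type) [Field K] [NumberField K],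
      gross_zagier N W K)
    (hKo : ∀ (N : ℕ) [NeZero N] (W : WeierstrassCurve ℚ) (K : Type) [Field K] [NumberField K],
      kolyvagin N W K)
    (hCM : bsdTriple_of_hasCM_of_L_one_ne_zero) (hKob : Kobayashi2013.cor14_bsdp_of_cm_rank_one)
    (hYZ : YanZhu2026.thm415_padicValRat_bsd_rank_le_one)
    (hLLT : LiLiuTian2024.thm11_bsdp_of_cm_rank_one)
    (hL0 : re_entireLFunction_one_nonneg) : WAllFormula :=
  wAllFormula_of_wAll_oneSign hmodP hL0 hWa hGZ
    (wAll_of_leaves_primaryGZ h5 hK1 hUp hK8 hK9t hK9w hK2a hK2b hK5 hK3 hK6 hX10b hX11a hIn hF2 hFr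
      hW hSk hBCS hJSW hCGS hGV hGr hmodP hWa hMM hGZ hKo hCM hKob hYZ hLLT)

/-- **THE FULL BSD FORMULA FOR EVERY `E/ℚ` OF ANALYTIC RANK `≤ 1`, FROM THE REGISTERED LEAVES**,
FOURTEEN named facts (Yan–Zhu (Im) kernel) and ONE sign binder `hL0`:
`wAllFormula_of_wAll_oneSign ∘ wAll_of_leaves_yanZhuImForm_primaryGZ`.
[cite: GrossZagier1986, Thm. V.(2.1) (p. 311) and V.§2 (pp. 312–313)]
[cite: Darmon2004, Thm. 3.22 and §3.9] -/
theorem wAllFormula_of_leaves_yanZhuImForm_primaryGZ (h5 : NonCMAtTwo)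
    (hK1 : Additive.AdditiveOrdinaryLowerHalf)
    (hUp : ∀ (W : WeierstrassCurve ℚ) [W.IsElliptic] [W.IsGloballyMinimal] (p : ℕ) [Fact p.Prime],
      W.analyticRank ≤ 1 → Additive.N10.Locus W p → MissingUpperBoundAt W p)
    (hK8 : Additive.O5SharpGss) (hK9t : Additive.O5SharpTprime) (hK9w : Additive.O6Sharp)
    (hK2a : X11b.MultiplicativeRankOne) (hK2b : X11b.MultiplicativeRankOneAtThree)
    (hK5 : Eisenstein.EisensteinPrimes) (hK3 : Supersingular.SignedSupersingular)
    (hK6 : BSDpOnClassX9) (hX10b : X10.BSDpOnClassX10b) (hX11a : X11a.Target)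
    (hIn : X12.CMInertBad) (hF2 : WAllCornerFTwo) (hFr : WAllCornerFRamified)
    (hW : sha_dvd_analyticSha)
    (hSk : Skinner2016.thmC_padicValRat_bsd_rank_zero)
    (hJSW : JetchevSkinnerWan2017.thm121_padicValRat_bsd_rank_one)
    (hCGS : CastellaGrossiSkinner2025.thmD_padicValRat_bsd_rank_le_one)
    (hGV : GreenbergVatsal2000.thm13_charIdeal_eq_of_gvPar) (hGr : greenberg_charValue_rankZero)
    (hmodP : nonempty_modularParametrizationData)
    (hWa : waldspurger_exists_heegnerField_twist_ne_zero)
    (hMM : murtyMurty_exists_heegnerField_twist_simpleZero)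
    (hGZ : ∀ (N : ℕ) [NeZero N] (W : WeierstrassCurve ℚ) (K : Type) [Field K] [NumberField K],
      gross_zagier N W K)
    (hKo : ∀ (N : ℕ) [NeZero N] (W : WeierstrassCurve ℚ) (K : Type) [Field K] [NumberField K],
      kolyvagin N W K)
    (hCM : bsdTriple_of_hasCM_of_L_one_ne_zero) (hKob : Kobayashi2013.cor14_bsdp_of_cm_rank_one)
    (hYZ : YanZhu2026.thm415_padicValRat_bsd_rank_le_one_of_bigIm)
    (hLLT : LiLiuTian2024.thm11_bsdp_of_cm_rank_one)
    (hL0 : re_entireLFunction_one_nonneg) : WAllFormula :=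
  wAllFormula_of_wAll_oneSign hmodP hL0 hWa hGZ
    (wAll_of_leaves_yanZhuImForm_primaryGZ h5 hK1 hUp hK8 hK9t hK9w hK2a hK2b hK5 hK3 hK6 hX10b hX11a
      hIn hF2 hFr hW hSk hJSW hCGS hGV hGr hmodP hWa hMM hGZ hKo hCM hKob hYZ hLLT)

end Summit.BirchSwinnertonDyer.Rank1Residual.WAll

end
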